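import Literature.MathematicalPhysics.QuantumFieldTheory.Balaban1983to89.B13EntrywiseWalks

/-!
# `Balaban1983to89.B13EntryLetterAlgebra` — T. Bałaban, *Propagators and renormalization transformations for lattice gauge
theories. II*, Commun. Math. Phys. **96** (1984) 223–250 [Balaban1984PropagatorsII], p. 232 («this property is preserved under
the composition of operators possessing it … a summation preserves it also», (2.52)–(2.55)) and Lemma 2.1 (2.61) p. 234 (the
row sum `Σ_{y′} e^{−αδ₀d(y,y′)} ≤ c₁`); *Propagators for lattice gauge theories in a background field*, Commun. Math. Phys. **99**
(1985) 389–434 [Balaban1985BackgroundPropagators], Thm 3.10 (3.107)–(3.108) p. 416 (the class of kernels with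
`|G(x,x′)| ≤ Be^{−δd(x,x′)}`); *Renormalization group approach to lattice gauge field theories. II. Cluster expansions*, Commun.
Math. Phys. **116** (1988) 1–22 [Balaban1988RG2Cluster], (2.5)–(2.6) p. 12 and p. 15 (the operators of the (2.14) terms are
finite sums of products of propagators of [13] sandwiched between local operators — averaging operators, characteristic
functions, covariant derivatives): THE ALGEBRA OF ENTRYWISE (3.108)-LETTERS.

Node N10's junction editions consume, per located kernel family `Δ₀(u)` (`u` in a complex ball of a configuration space
`E`), the TWO ENTRYWISE LETTERS `B13EntrywiseWalks.RawEntryLetters Δ₀ loc R ρ B`: `‖Δ₀(u)_{ij}‖ ≤ Be^{−ρd₁(loc i, loc j)}` on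
the `R`-ball and entrywise holomorphy.  `B13WalksOfB9Factors` produces these letters for the propagators `G(U)` of [13]
Thm 3.10 from node N06's typed letters; the kernels of [Balaban1988RG2Cluster] (2.14) are ALGEBRAIC EXPRESSIONS in such
propagators and local operators.  This file types the closure of the letters under that algebra, with the printed
bookkeeping of constants and rates ([Balaban1984PropagatorsII] p. 232, (2.61)):

WHAT THIS FILE PROVES (all `theorem`s; no `def`, no instance, no notation).
§1 bookkeeping: `rawEntryLetters_mono` (shrink the ball, lower the rate, raise the constant), `rawEntryLetters_congr`
   (agreement on the ball), `rawEntryLetters_const` ∕ `_zero` ∕ `_one`, `rawEntryLetters_of_range` (a `u`-constant matrix of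
   range `r` and entry bound `a` has letters at every rate `ρ ≥ 0`, constant `ae^{ρr}`), `rawEntryLetters_transpose`,
   `rawEntryLetters_submatrix`.
§2 linear structure («a summation preserves it»): `rawEntryLetters_add` (`B₁ + B₂`), `_smul` (`‖a‖B`), `_neg`, `_sub`, `_sum`
   (`Σ B_i`).
§3 ★ products («preserved under composition», (2.52)–(2.55) with the row sum (2.61)): `sum_fiber_le` (a sum over the index
   set is at most the fibre bound `m` times the sum over the torus); ★ `rawEntryLetters_mul` — letters `(R, ρ₁, B₁)` and
   `(R, ρ₂, B₂)` give letters `(R, κ, B₁B₂·mC)` for the product at every `κ ≤ ρ₁`, `κ + μ ≤ ρ₂`, `C` a row-sum constant at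
   rate `μ ≥ 0`; `rawEntryLetters_mul'` (the mirror `κ + μ ≤ ρ₁`, `κ ≤ ρ₂`); `rawEntryLetters_mul_torus` (the row sum
   DISCHARGED on every torus: `C = c₀(1,μ)^ν`, `B13LocalKernelWalks.rowSum_torus`); ★ `rawEntryLetters_pow` — THE RATE IS LOST
   ONCE: `Δ^{n+1}` has letters `(R, ρ − μ, B^{n+1}(mC)^n)` ([Balaban1984PropagatorsII] (2.55): the random-walk bound behind
   every Neumann series of the programme).
§4 ★ sandwiches by local `u`-constant matrices (NO rate loss, [Balaban1988RG2Cluster] (2.5): `Q`, `Q*`, characteristic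
   functions): `rawEntryLetters_sandwich` — `A·Δ₀(u)·B′` for rectangular `A`, `B′` of range `r` (entries vanish beyond
   `d₁`-distance `r` between the locations) with row ∕ column `ℓ¹` bounds `a`, `b` has letters `(R, ρ, abBe^{2ρr})` located by
   the outer index; `rawEntryLetters_diagonal_sandwich` — diagonal sandwiches `h·Δ₀·h′` with `‖h‖, ‖h′‖ ≤ 1` keep the letters;
   `rawEntryLetters_local_mul` ∕ `rawEntryLetters_mul_local` — one-sided multiplication by a local matrix (`aBe^{2ρr}` ∕ `bBe^{2ρr}`);
   helpers `range_diagonal`, `rowsum_diagonal`, `colsum_diagonal`.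
HONEST FRAMING: kernel-level bookkeeping over a hypothesis schema of printed shape (entrywise decay + holomorphy); nothing of
Bałaban's is constructed or asserted; no node is discharged; count-neutral; no `sorry`, no new named fact; standard axioms;
nothing continuum ∕ ℝ⁴ ∕ OS ∕ mass gap ∕ Clay.
-/

noncomputable section

namespace Literature.MathematicalPhysics.QuantumFieldTheory.Balaban1983to89.B13EntryLetterAlgebra

open Metric Set Finset
open scoped Matrix
open Literature.MathematicalPhysics.QuantumFieldTheory.Balaban1983to89
open Literature.MathematicalPhysics.QuantumFieldTheory.Balaban1983to89.B9Thm34Ext (toB6)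
open Literature.MathematicalPhysics.QuantumFieldTheory.Balaban1983to89.B9Thm37GlueTorus
  (torusGeom tdist1 tdist1_nonneg tdist1_comm tdist1_triangle tdist1_self)
open Literature.MathematicalPhysics.QuantumFieldTheory.Balaban1983to89.B5TorusCover (UT)
open Literature.MathematicalPhysics.QuantumFieldTheory.Balaban1983to89.B13EntrywiseWalks (RawEntryLetters)
open Literature.MathematicalPhysics.QuantumFieldTheory.Balaban1983to89.B13LocalKernelWalks (rowSum_torus)

variable {ν : ℕ} {Nf : Fin ν → ℕ} [∀ i, NeZero (Nf i)]
variable {E : Type*} [NormedAddCommGroup E] [NormedSpace ℂ E]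
variable {p q : Type} [Fintype p] [DecidableEq p] [Fintype q] [DecidableEq q]

/-! ## §1. Bookkeeping -/

section Bookkeeping

variable {Δ : E → Matrix p p ℂ} {loc : p → UT Nf} {R ρ B : ℝ}

omit [Fintype p] [DecidableEq p] in
/-- Shrinking the ball, lowering the rate and raising the constant keep the letters.
[cite: Balaban1985BackgroundPropagators, (3.108) p.416] -/
theorem rawEntryLetters_mono (h : RawEntryLetters Δ loc R ρ B) {R' ρ' B' : ℝ} (hR : R' ≤ R) (hρ : ρ' ≤ ρ) (hB : B ≤ B') :
    RawEntryLetters Δ loc R' ρ' B' where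
  decay u hu i j := by
    refine (h.decay u (ball_subset_ball hR hu) i j).trans ?_
    refine mul_le_mul hB (Real.exp_le_exp.2 ?_) (Real.exp_nonneg _) (h.B_nonneg.trans hB)
    exact neg_le_neg (mul_le_mul_of_nonneg_right hρ (tdist1_nonneg _ _))
  holo i j := (h.holo i j).mono (ball_subset_ball hR)
  B_nonneg := h.B_nonneg.trans hB

omit [Fintype p] [DecidableEq p] in
/-- A family agreeing with `Δ₀` on the ball has the same letters. [cite: Balaban1985BackgroundPropagators, (3.108) p.416] -/
theorem rawEntryLetters_congr (h : RawEntryLetters Δ loc R ρ B) {Δ' : E → Matrix p p ℂ}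
    (heq : ∀ u ∈ ball (0 : E) R, Δ' u = Δ u) : RawEntryLetters Δ' loc R ρ B where
  decay u hu i j := by rw [heq u hu]; exact h.decay u hu i j
  holo i j := (h.holo i j).congr fun u hu => by rw [heq u hu]
  B_nonneg := h.B_nonneg

omit [Fintype p] [DecidableEq p] in
/-- A `u`-constant matrix with (3.108)-type entries has the letters (holomorphy is free).
[cite: Balaban1985BackgroundPropagators, (3.108) p.416] -/
theorem rawEntryLetters_const {A : Matrix p p ℂ} (loc : p → UT Nf) (R : ℝ) {ρ B : ℝ} (hB : 0 ≤ B)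
    (hA : ∀ i j, ‖A i j‖ ≤ B * Real.exp (-(ρ * tdist1 Nf (loc i) (loc j)))) :
    RawEntryLetters (fun _ : E => A) loc R ρ B where
  decay _ _ i j := hA i j
  holo _ _ := differentiableOn_const _
  B_nonneg := hB

omit [Fintype p] [DecidableEq p] in
/-- The zero family has the letters with constant `0`. [cite: Balaban1985BackgroundPropagators, (3.108) p.416] -/
theorem rawEntryLetters_zero (loc : p → UT Nf) (R ρ : ℝ) : RawEntryLetters (fun _ : E => (0 : Matrix p p ℂ)) loc R ρ 0 :=
  rawEntryLetters_const loc R le_rfl fun i j => by simp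

omit [Fintype p] in
/-- The identity has the letters with constant `1` at every rate (`d₁(y,y) = 0`).
[cite: Balaban1985BackgroundPropagators, (3.108) p.416] -/
theorem rawEntryLetters_one (loc : p → UT Nf) (R ρ : ℝ) : RawEntryLetters (fun _ : E => (1 : Matrix p p ℂ)) loc R ρ 1 := by
  refine rawEntryLetters_const loc R zero_le_one fun i j => ?_
  by_cases hij : i = j
  · subst hij; simp [tdist1_self]
  · rw [Matrix.one_apply_ne hij, norm_zero]; positivity

omit [Fintype p] [DecidableEq p] in
/-- A `u`-constant matrix of RANGE `r` (entries vanish beyond `d₁`-distance `r`) with entry bound `a` has the letters at every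
rate `ρ ≥ 0` with constant `ae^{ρr}` — the local operators of [Balaban1988RG2Cluster] (2.5).
[cite: Balaban1988RG2Cluster, (2.5) p.12; Balaban1985BackgroundPropagators, (3.108) p.416] -/
theorem rawEntryLetters_of_range {A : Matrix p p ℂ} (loc : p → UT Nf) (R : ℝ) {ρ r a : ℝ} (hρ : 0 ≤ ρ) (ha : 0 ≤ a)
    (hsupp : ∀ i j, A i j ≠ 0 → tdist1 Nf (loc i) (loc j) ≤ r) (hbd : ∀ i j, ‖A i j‖ ≤ a) :
    RawEntryLetters (fun _ : E => A) loc R ρ (a * Real.exp (ρ * r)) := by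
  refine rawEntryLetters_const loc R (by positivity) fun i j => ?_
  by_cases h0 : A i j = 0
  · rw [h0, norm_zero]; positivity
  · have hd := hsupp i j h0
    calc ‖A i j‖ ≤ a * 1 := by rw [mul_one]; exact hbd i j
      _ ≤ a * (Real.exp (ρ * r) * Real.exp (-(ρ * tdist1 Nf (loc i) (loc j)))) := by
          refine mul_le_mul_of_nonneg_left ?_ ha
          rw [← Real.exp_add]
          exact Real.one_le_exp (by nlinarith)
      _ = a * Real.exp (ρ * r) * Real.exp (-(ρ * tdist1 Nf (loc i) (loc j))) := by ring

omit [Fintype p] [DecidableEq p] in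
/-- Transposition keeps the letters (`d₁` is symmetric). [cite: Balaban1985BackgroundPropagators, (3.108) p.416] -/
theorem rawEntryLetters_transpose (h : RawEntryLetters Δ loc R ρ B) :
    RawEntryLetters (fun u => (Δ u)ᵀ) loc R ρ B where
  decay u hu i j := by rw [Matrix.transpose_apply, tdist1_comm]; exact h.decay u hu j i
  holo i j := h.holo j i
  B_nonneg := h.B_nonneg

omit [Fintype p] [DecidableEq p] [Fintype q] [DecidableEq q] in
/-- Re-indexing along any map keeps the letters (located by the composed location map).
[cite: Balaban1985BackgroundPropagators, (3.108) p.416] -/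
theorem rawEntryLetters_submatrix (h : RawEntryLetters Δ loc R ρ B) (e : q → p) :
    RawEntryLetters (fun u => (Δ u).submatrix e e) (loc ∘ e) R ρ B where
  decay u hu i j := h.decay u hu (e i) (e j)
  holo i j := h.holo (e i) (e j)
  B_nonneg := h.B_nonneg

end Bookkeeping

/-! ## §2. Linear structure — «a summation preserves it also» -/

section Linear

variable {Δ Δ₁ Δ₂ : E → Matrix p p ℂ} {loc : p → UT Nf} {R ρ B B₁ B₂ : ℝ}

omit [Fintype p] [DecidableEq p] in
/-- Sums: the constants add. [cite: Balaban1984PropagatorsII, p.232] -/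
theorem rawEntryLetters_add (h₁ : RawEntryLetters Δ₁ loc R ρ B₁) (h₂ : RawEntryLetters Δ₂ loc R ρ B₂) :
    RawEntryLetters (fun u => Δ₁ u + Δ₂ u) loc R ρ (B₁ + B₂) where
  decay u hu i j := by
    rw [Matrix.add_apply, add_mul]
    exact (norm_add_le _ _).trans (add_le_add (h₁.decay u hu i j) (h₂.decay u hu i j))
  holo i j := (h₁.holo i j).add (h₂.holo i j)
  B_nonneg := add_nonneg h₁.B_nonneg h₂.B_nonneg

omit [Fintype p] [DecidableEq p] in
/-- Scalar multiples: the constant scales by `‖a‖`. [cite: Balaban1984PropagatorsII, p.232] -/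
theorem rawEntryLetters_smul (h : RawEntryLetters Δ loc R ρ B) (a : ℂ) :
    RawEntryLetters (fun u => a • Δ u) loc R ρ (‖a‖ * B) where
  decay u hu i j := by
    rw [Matrix.smul_apply, smul_eq_mul, norm_mul, mul_assoc]
    exact mul_le_mul_of_nonneg_left (h.decay u hu i j) (norm_nonneg _)
  holo i j := (h.holo i j).const_smul a
  B_nonneg := mul_nonneg (norm_nonneg _) h.B_nonneg

omit [Fintype p] [DecidableEq p] in
/-- Negation keeps the letters. [cite: Balaban1984PropagatorsII, p.232] -/
theorem rawEntryLetters_neg (h : RawEntryLetters Δ loc R ρ B) : RawEntryLetters (fun u => -Δ u) loc R ρ B where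
  decay u hu i j := by rw [Matrix.neg_apply, norm_neg]; exact h.decay u hu i j
  holo i j := (h.holo i j).neg
  B_nonneg := h.B_nonneg

omit [Fintype p] [DecidableEq p] in
/-- Differences: the constants add. [cite: Balaban1984PropagatorsII, p.232] -/
theorem rawEntryLetters_sub (h₁ : RawEntryLetters Δ₁ loc R ρ B₁) (h₂ : RawEntryLetters Δ₂ loc R ρ B₂) :
    RawEntryLetters (fun u => Δ₁ u - Δ₂ u) loc R ρ (B₁ + B₂) := by
  simpa [sub_eq_add_neg] using rawEntryLetters_add h₁ (rawEntryLetters_neg h₂)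

omit [Fintype p] [DecidableEq p] in
/-- Finite sums: the constants add up. [cite: Balaban1984PropagatorsII, p.232] -/
theorem rawEntryLetters_sum {ι : Type*} (s : Finset ι) {Δ : ι → E → Matrix p p ℂ} {B : ι → ℝ}
    (h : ∀ k ∈ s, RawEntryLetters (Δ k) loc R ρ (B k)) :
    RawEntryLetters (fun u => ∑ k ∈ s, Δ k u) loc R ρ (∑ k ∈ s, B k) := by
  induction s using Finset.cons_induction with
  | empty => simpa using rawEntryLetters_zero (E := E) loc R ρ
  | cons a s ha ih =>
      have h' := rawEntryLetters_add (h a (mem_cons_self a s)) (ih fun k hk => h k (mem_cons.2 (Or.inr hk)))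
      simpa [Finset.sum_cons, ha] using h'

end Linear

/-! ## §3. Products — «preserved under the composition of operators possessing it» -/

section Products

variable {Δ Δ₁ Δ₂ : E → Matrix p p ℂ} {loc : p → UT Nf} {R ρ ρ₁ ρ₂ B B₁ B₂ μ C κ : ℝ} {m : ℕ}

omit [DecidableEq p] [∀ i, NeZero (Nf i)] in
/-- A sum over the index set of a function of the LOCATION is at most the fibre bound `m` times the sum over the torus.
[cite: Balaban1984PropagatorsII, (2.52) p.232] -/
theorem sum_fiber_le (hfib : ∀ y : UT Nf, (univ.filter fun k => loc k = y).card ≤ m) {f : UT Nf → ℝ}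
    (hf : ∀ y, 0 ≤ f y) : ∑ k : p, f (loc k) ≤ m * ∑ y : UT Nf, f y := by
  classical
  rw [← Finset.sum_fiberwise univ loc fun k => f (loc k), mul_sum]
  refine sum_le_sum fun y _ => ?_
  have hc : ∑ k ∈ univ.filter (fun k => loc k = y), f (loc k) = (univ.filter fun k => loc k = y).card * f y := by
    rw [sum_congr rfl fun k hk => by rw [(mem_filter.1 hk).2], sum_const, nsmul_eq_mul]
  rw [hc]
  exact mul_le_mul_of_nonneg_right (by exact_mod_cast hfib y) (hf y)

omit [DecidableEq p] in
/-- The two-step exponent bookkeeping: at target rate `κ ≤ ρ₁`, `κ + μ ≤ ρ₂` the weight `e^{−ρ₁d(i,k)}e^{−ρ₂d(k,j)}` is at most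
`e^{−κd(i,j)}e^{−μd(k,j)}` (triangle inequality). [cite: Balaban1984PropagatorsII, (2.54)–(2.55) p.232] -/
theorem exp_two_step_le (hκ : 0 ≤ κ) (hκ₁ : κ ≤ ρ₁) (hκ₂ : κ + μ ≤ ρ₂) (a y b : UT Nf) :
    Real.exp (-(ρ₁ * tdist1 Nf a y)) * Real.exp (-(ρ₂ * tdist1 Nf y b)) ≤
      Real.exp (-(κ * tdist1 Nf a b)) * Real.exp (-(μ * tdist1 Nf y b)) := by
  rw [← Real.exp_add, ← Real.exp_add]
  refine Real.exp_le_exp.2 ?_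
  have htri := tdist1_triangle a y b
  have h1 := tdist1_nonneg a y
  have h2 := tdist1_nonneg y b
  nlinarith [mul_le_mul_of_nonneg_left htri hκ, mul_nonneg (sub_nonneg.2 hκ₁) h1, mul_nonneg (sub_nonneg.2 hκ₂) h2]

omit [DecidableEq p] in
/-- ★ **PRODUCTS** ([Balaban1984PropagatorsII] (2.52)–(2.55) with the row sum (2.61)): letters `(R, ρ₁, B₁)` and `(R, ρ₂, B₂)`
give, for the product family, letters `(R, κ, B₁B₂·mC)` at every target rate `0 ≤ κ ≤ ρ₁` with `κ + μ ≤ ρ₂`, where `m` bounds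
the fibres of the location map and `C` is a row-sum constant of the torus at rate `μ`.
[cite: Balaban1984PropagatorsII, (2.52)–(2.55) p.232, (2.61) p.234; Balaban1985BackgroundPropagators, (3.108) p.416] -/
theorem rawEntryLetters_mul (h₁ : RawEntryLetters Δ₁ loc R ρ₁ B₁) (h₂ : RawEntryLetters Δ₂ loc R ρ₂ B₂)
    (hκ : 0 ≤ κ) (hκ₁ : κ ≤ ρ₁) (hκ₂ : κ + μ ≤ ρ₂) (hC : 0 ≤ C)
    (hfib : ∀ y : UT Nf, (univ.filter fun k => loc k = y).card ≤ m)
    (hrow : ∀ a : UT Nf, ∑ z : UT Nf, Real.exp (-(μ * tdist1 Nf a z)) ≤ C) :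
    RawEntryLetters (fun u => Δ₁ u * Δ₂ u) loc R κ (B₁ * B₂ * (m * C)) where
  decay u hu i j := by
    rw [Matrix.mul_apply]
    have hterm : ∀ k, ‖Δ₁ u i k * Δ₂ u k j‖ ≤
        B₁ * B₂ * Real.exp (-(κ * tdist1 Nf (loc i) (loc j))) * Real.exp (-(μ * tdist1 Nf (loc j) (loc k))) := by
      intro k
      rw [norm_mul]
      refine (mul_le_mul (h₁.decay u hu i k) (h₂.decay u hu k j) (norm_nonneg _)
        (mul_nonneg h₁.B_nonneg (Real.exp_nonneg _))).trans ?_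
      have hstep := exp_two_step_le (Nf := Nf) (μ := μ) hκ hκ₁ hκ₂ (loc i) (loc k) (loc j)
      rw [tdist1_comm (loc j) (loc k)]
      calc B₁ * Real.exp (-(ρ₁ * tdist1 Nf (loc i) (loc k))) * (B₂ * Real.exp (-(ρ₂ * tdist1 Nf (loc k) (loc j))))
          = B₁ * B₂ * (Real.exp (-(ρ₁ * tdist1 Nf (loc i) (loc k))) * Real.exp (-(ρ₂ * tdist1 Nf (loc k) (loc j)))) := by
            ring
        _ ≤ B₁ * B₂ * (Real.exp (-(κ * tdist1 Nf (loc i) (loc j))) * Real.exp (-(μ * tdist1 Nf (loc k) (loc j)))) :=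
            mul_le_mul_of_nonneg_left hstep (mul_nonneg h₁.B_nonneg h₂.B_nonneg)
        _ = _ := by ring
    refine (norm_sum_le _ _).trans ((sum_le_sum fun k _ => hterm k).trans ?_)
    rw [← mul_sum]
    have hS : ∑ k : p, Real.exp (-(μ * tdist1 Nf (loc j) (loc k))) ≤ m * C :=
      (sum_fiber_le hfib (f := fun y => Real.exp (-(μ * tdist1 Nf (loc j) y))) fun _ => Real.exp_nonneg _).trans
        (mul_le_mul_of_nonneg_left (hrow (loc j)) (Nat.cast_nonneg _))
    calc B₁ * B₂ * Real.exp (-(κ * tdist1 Nf (loc i) (loc j))) * ∑ k : p, Real.exp (-(μ * tdist1 Nf (loc j) (loc k)))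
        ≤ B₁ * B₂ * Real.exp (-(κ * tdist1 Nf (loc i) (loc j))) * (m * C) :=
          mul_le_mul_of_nonneg_left hS (mul_nonneg (mul_nonneg h₁.B_nonneg h₂.B_nonneg) (Real.exp_nonneg _))
      _ = B₁ * B₂ * (m * C) * Real.exp (-(κ * tdist1 Nf (loc i) (loc j))) := by ring
  holo i j := by
    have : (fun u => (Δ₁ u * Δ₂ u) i j) = fun u => ∑ k, Δ₁ u i k * Δ₂ u k j := by
      funext u; rw [Matrix.mul_apply]
    rw [this]
    exact DifferentiableOn.fun_sum fun k _ => (h₁.holo i k).mul (h₂.holo k j)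
  B_nonneg := mul_nonneg (mul_nonneg h₁.B_nonneg h₂.B_nonneg) (mul_nonneg (Nat.cast_nonneg _) hC)

omit [DecidableEq p] in
/-- The mirror bookkeeping `κ + μ ≤ ρ₁`, `κ ≤ ρ₂` (transpose, multiply, transpose back).
[cite: Balaban1984PropagatorsII, (2.52)–(2.55) p.232, (2.61) p.234] -/
theorem rawEntryLetters_mul' (h₁ : RawEntryLetters Δ₁ loc R ρ₁ B₁) (h₂ : RawEntryLetters Δ₂ loc R ρ₂ B₂)
    (hκ : 0 ≤ κ) (hκ₁ : κ + μ ≤ ρ₁) (hκ₂ : κ ≤ ρ₂) (hC : 0 ≤ C)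
    (hfib : ∀ y : UT Nf, (univ.filter fun k => loc k = y).card ≤ m)
    (hrow : ∀ a : UT Nf, ∑ z : UT Nf, Real.exp (-(μ * tdist1 Nf a z)) ≤ C) :
    RawEntryLetters (fun u => Δ₁ u * Δ₂ u) loc R κ (B₁ * B₂ * (m * C)) := by
  have h := rawEntryLetters_transpose
    (rawEntryLetters_mul (rawEntryLetters_transpose h₂) (rawEntryLetters_transpose h₁) hκ hκ₂ hκ₁ hC hfib hrow)
  refine rawEntryLetters_mono (rawEntryLetters_congr h fun u _ => ?_) le_rfl le_rfl (le_of_eq (by ring))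
  rw [← Matrix.transpose_mul, Matrix.transpose_transpose]

omit [DecidableEq p] in
/-- The row sum DISCHARGED on every torus (`rowSum_torus`: `C = c₀(1,μ)^ν` for `μ > 0`).
[cite: Balaban1984PropagatorsII, Lemma 2.1 (2.61) p.234, (2.52)–(2.55) p.232] -/
theorem rawEntryLetters_mul_torus (h₁ : RawEntryLetters Δ₁ loc R ρ₁ B₁) (h₂ : RawEntryLetters Δ₂ loc R ρ₂ B₂)
    (hμ : 0 < μ) (hκ : 0 ≤ κ) (hκ₁ : κ ≤ ρ₁) (hκ₂ : κ + μ ≤ ρ₂)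
    (hfib : ∀ y : UT Nf, (univ.filter fun k => loc k = y).card ≤ m) :
    RawEntryLetters (fun u => Δ₁ u * Δ₂ u) loc R κ (B₁ * B₂ * (m * B6.c0 1 μ ^ ν)) :=
  rawEntryLetters_mul h₁ h₂ hκ hκ₁ hκ₂ (pow_nonneg (B6RandomWalk.c0_nonneg 1 μ) ν) hfib fun a => rowSum_torus Nf hμ a

/-- ★ **POWERS — THE RATE IS LOST ONCE** ([Balaban1984PropagatorsII] (2.55): the random-walk bound behind every Neumann series of
the programme): letters `(R, ρ, B)` give, for `Δ₀(u)^{n+1}`, letters `(R, ρ − μ, B^{n+1}(mC)^n)` for every `0 ≤ μ ≤ ρ`.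
[cite: Balaban1984PropagatorsII, (2.55) p.232, (2.61) p.234; Balaban1985BackgroundPropagators, (3.106)–(3.108) p.416] -/
theorem rawEntryLetters_pow (h : RawEntryLetters Δ loc R ρ B) (hμ : 0 ≤ μ) (hμρ : μ ≤ ρ) (hC : 0 ≤ C)
    (hfib : ∀ y : UT Nf, (univ.filter fun k => loc k = y).card ≤ m)
    (hrow : ∀ a : UT Nf, ∑ z : UT Nf, Real.exp (-(μ * tdist1 Nf a z)) ≤ C) (n : ℕ) :
    RawEntryLetters (fun u => Δ u ^ (n + 1)) loc R (ρ - μ) (B ^ (n + 1) * (m * C) ^ n) := by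
  induction n with
  | zero => simpa using rawEntryLetters_mono h le_rfl (by linarith) le_rfl
  | succ n ih =>
      have hstep := rawEntryLetters_mul ih h (κ := ρ - μ) (μ := μ) (by linarith) le_rfl (by linarith) hC hfib hrow
      refine rawEntryLetters_mono (rawEntryLetters_congr hstep fun u _ => by rw [pow_succ]) le_rfl le_rfl (le_of_eq ?_)
      ring

end Products

/-! ## §4. Sandwiches by local `u`-constant matrices — no rate loss -/

section Sandwich

variable {Δ : E → Matrix q q ℂ} {loc : q → UT Nf} {locp : p → UT Nf} {R ρ B : ℝ}

omit [Fintype p] [DecidableEq p] [DecidableEq q] in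
/-- ★ **SANDWICHES** ([Balaban1988RG2Cluster] (2.5): averaging operators, their adjoints, characteristic functions around a
propagator of [13]): for rectangular `u`-constant `A` (`p × q`) and `B′` (`q × p`) of RANGE `r` — an entry vanishes when its
two locations are more than `r` apart — with row sums `Σ_k ‖A_{ik}‖ ≤ a` and column sums `Σ_l ‖B′_{lj}‖ ≤ b`, the family
`A·Δ₀(u)·B′` has letters `(R, ρ, abBe^{2ρr})` located by the outer index: NO loss of rate.
[cite: Balaban1988RG2Cluster, (2.5)–(2.6) p.12; Balaban1985BackgroundPropagators, (3.108) p.416; Balaban1984PropagatorsII, (2.54) p.232] -/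
theorem rawEntryLetters_sandwich (h : RawEntryLetters Δ loc R ρ B) (hρ : 0 ≤ ρ) {A : Matrix p q ℂ} {B' : Matrix q p ℂ}
    {r a b : ℝ} (ha : 0 ≤ a) (hb : 0 ≤ b)
    (hAr : ∀ i k, A i k ≠ 0 → tdist1 Nf (locp i) (loc k) ≤ r) (hAa : ∀ i, ∑ k, ‖A i k‖ ≤ a)
    (hBr : ∀ l j, B' l j ≠ 0 → tdist1 Nf (loc l) (locp j) ≤ r) (hBb : ∀ j, ∑ l, ‖B' l j‖ ≤ b) :
    RawEntryLetters (fun u => A * Δ u * B') locp R ρ (a * b * B * Real.exp (2 * ρ * r)) where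
  decay u hu i j := by
    set X : ℝ := B * Real.exp (2 * ρ * r) * Real.exp (-(ρ * tdist1 Nf (locp i) (locp j))) with hX
    have hX0 : 0 ≤ X := by have := h.B_nonneg; rw [hX]; positivity
    -- one term of the double sum
    have hterm : ∀ k l, ‖A i k‖ * ‖Δ u k l‖ * ‖B' l j‖ ≤ ‖A i k‖ * ‖B' l j‖ * X := by
      intro k l
      by_cases hA0 : A i k = 0
      · rw [hA0, norm_zero]; simp
      by_cases hB0 : B' l j = 0
      · rw [hB0, norm_zero]; simp
      have hd : tdist1 Nf (locp i) (locp j) ≤ 2 * r + tdist1 Nf (loc k) (loc l) := by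
        have := tdist1_triangle (N := Nf) (locp i) (loc k) (locp j)
        have := tdist1_triangle (N := Nf) (loc k) (loc l) (locp j)
        linarith [hAr i k hA0, hBr l j hB0]
      have hΔ : ‖Δ u k l‖ ≤ X := by
        refine (h.decay u hu k l).trans ?_
        rw [hX, mul_assoc, ← Real.exp_add]
        exact mul_le_mul_of_nonneg_left (Real.exp_le_exp.2 (by nlinarith)) h.B_nonneg
      calc ‖A i k‖ * ‖Δ u k l‖ * ‖B' l j‖ = ‖A i k‖ * ‖B' l j‖ * ‖Δ u k l‖ := by ring
        _ ≤ ‖A i k‖ * ‖B' l j‖ * X := mul_le_mul_of_nonneg_left hΔ (mul_nonneg (norm_nonneg _) (norm_nonneg _))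
    -- the double sum
    have hsum : ‖(A * Δ u * B') i j‖ ≤ ∑ l, ∑ k, ‖A i k‖ * ‖Δ u k l‖ * ‖B' l j‖ := by
      rw [Matrix.mul_apply]
      refine (norm_sum_le _ _).trans (sum_le_sum fun l _ => ?_)
      rw [norm_mul, Matrix.mul_apply, ← sum_mul]
      exact mul_le_mul_of_nonneg_right ((norm_sum_le _ _).trans (sum_le_sum fun k _ => (norm_mul_le _ _)))
        (norm_nonneg _)
    refine hsum.trans (((sum_le_sum fun l _ => sum_le_sum fun k _ => hterm k l)).trans ?_)
    have hinner : ∀ l, ∑ k, ‖A i k‖ * ‖B' l j‖ * X = (∑ k, ‖A i k‖) * (‖B' l j‖ * X) := fun l => by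
      rw [sum_mul]
      exact sum_congr rfl fun k _ => by ring
    calc ∑ l, ∑ k, ‖A i k‖ * ‖B' l j‖ * X = ∑ l, (∑ k, ‖A i k‖) * (‖B' l j‖ * X) := sum_congr rfl fun l _ => hinner l
      _ ≤ ∑ l, a * (‖B' l j‖ * X) :=
          sum_le_sum fun l _ => mul_le_mul_of_nonneg_right (hAa i) (mul_nonneg (norm_nonneg _) hX0)
      _ = a * X * ∑ l, ‖B' l j‖ := by rw [← mul_sum, ← sum_mul]; ring
      _ ≤ a * X * b := mul_le_mul_of_nonneg_left (hBb j) (mul_nonneg ha hX0)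
      _ = a * b * B * Real.exp (2 * ρ * r) * Real.exp (-(ρ * tdist1 Nf (locp i) (locp j))) := by rw [hX]; ring
  holo i j := by
    have : (fun u => (A * Δ u * B') i j) = fun u => ∑ l, (∑ k, A i k * Δ u k l) * B' l j := by
      funext u; simp only [Matrix.mul_apply]
    rw [this]
    refine DifferentiableOn.fun_sum fun l _ => DifferentiableOn.mul ?_ (differentiableOn_const _)
    exact DifferentiableOn.fun_sum fun k _ => (differentiableOn_const _).mul (h.holo k l)
  B_nonneg := by have := h.B_nonneg; positivity

omit [Fintype p] in
/-- A diagonal matrix has range `0`. [cite: Balaban1985BackgroundPropagators, (3.87) p.413] -/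
theorem range_diagonal (loc : p → UT Nf) (v : p → ℂ) (i k : p) (hik : Matrix.diagonal v i k ≠ 0) :
    tdist1 Nf (loc i) (loc k) ≤ 0 := by
  by_cases e : i = k
  · subst e; rw [tdist1_self]
  · exact absurd (Matrix.diagonal_apply_ne v e) hik

omit [∀ i, NeZero (Nf i)] in
/-- Row sums of a diagonal matrix. [cite: Balaban1985BackgroundPropagators, (3.87) p.413] -/
theorem rowsum_diagonal (v : p → ℂ) (i : p) : ∑ k, ‖Matrix.diagonal v i k‖ = ‖v i‖ := by
  rw [Finset.sum_eq_single i, Matrix.diagonal_apply_eq]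
  · intro k _ hk; rw [Matrix.diagonal_apply_ne v (Ne.symm hk), norm_zero]
  · intro hi; exact absurd (Finset.mem_univ i) hi

omit [∀ i, NeZero (Nf i)] in
/-- Column sums of a diagonal matrix. [cite: Balaban1985BackgroundPropagators, (3.87) p.413] -/
theorem colsum_diagonal (v : p → ℂ) (j : p) : ∑ l, ‖Matrix.diagonal v l j‖ = ‖v j‖ := by
  rw [Finset.sum_eq_single j, Matrix.diagonal_apply_eq]
  · intro l _ hl; rw [Matrix.diagonal_apply_ne v hl, norm_zero]
  · intro hj; exact absurd (Finset.mem_univ j) hj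

/-- Diagonal sandwiches `h·Δ₀(u)·h′` with `‖h‖, ‖h′‖ ≤ 1` (characteristic functions, partitions of unity, the `h_□` of [13]
(3.87)) keep the letters. [cite: Balaban1985BackgroundPropagators, (3.87) p.413, (3.108) p.416; Balaban1988RG2Cluster, (2.5) p.12] -/
theorem rawEntryLetters_diagonal_sandwich {Δ : E → Matrix p p ℂ} {loc : p → UT Nf} (h : RawEntryLetters Δ loc R ρ B)
    (hρ : 0 ≤ ρ) {dl dr : p → ℂ} (hl : ∀ i, ‖dl i‖ ≤ 1) (hr : ∀ i, ‖dr i‖ ≤ 1) :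
    RawEntryLetters (fun u => Matrix.diagonal dl * Δ u * Matrix.diagonal dr) loc R ρ B := by
  have hs := rawEntryLetters_sandwich (locp := loc) h hρ (A := Matrix.diagonal dl) (B' := Matrix.diagonal dr) (r := 0)
    zero_le_one zero_le_one (range_diagonal loc dl) (fun i => (rowsum_diagonal dl i).le.trans (hl i))
    (range_diagonal loc dr) (fun j => (colsum_diagonal dr j).le.trans (hr j))
  exact rawEntryLetters_mono hs le_rfl le_rfl (le_of_eq (by simp))

/-- LEFT multiplication by a `u`-constant local matrix of range `r ≥ 0` with row sums `≤ a`: letters `(R, ρ, aBe^{2ρr})`, no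
rate loss. [cite: Balaban1988RG2Cluster, (2.5) p.12; Balaban1985BackgroundPropagators, (3.108) p.416] -/
theorem rawEntryLetters_local_mul {Δ : E → Matrix p p ℂ} {loc : p → UT Nf} (h : RawEntryLetters Δ loc R ρ B) (hρ : 0 ≤ ρ)
    {A : Matrix p p ℂ} {r a : ℝ} (hr : 0 ≤ r) (ha : 0 ≤ a)
    (hAr : ∀ i k, A i k ≠ 0 → tdist1 Nf (loc i) (loc k) ≤ r) (hAa : ∀ i, ∑ k, ‖A i k‖ ≤ a) :
    RawEntryLetters (fun u => A * Δ u) loc R ρ (a * B * Real.exp (2 * ρ * r)) := by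
  have hs := rawEntryLetters_sandwich (locp := loc) h hρ (A := A) (B' := Matrix.diagonal fun _ => (1 : ℂ)) (r := r)
    ha zero_le_one hAr hAa (fun l j hlj => (range_diagonal loc _ l j hlj).trans hr)
    (fun j => by rw [colsum_diagonal, norm_one])
  refine rawEntryLetters_mono (rawEntryLetters_congr hs fun u _ => ?_) le_rfl le_rfl (le_of_eq (by ring))
  rw [Matrix.diagonal_one, Matrix.mul_one]

/-- RIGHT multiplication by a `u`-constant local matrix of range `r ≥ 0` with column sums `≤ b`: letters `(R, ρ, bBe^{2ρr})`,
no rate loss. [cite: Balaban1988RG2Cluster, (2.5) p.12; Balaban1985BackgroundPropagators, (3.108) p.416] -/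
theorem rawEntryLetters_mul_local {Δ : E → Matrix p p ℂ} {loc : p → UT Nf} (h : RawEntryLetters Δ loc R ρ B) (hρ : 0 ≤ ρ)
    {B' : Matrix p p ℂ} {r b : ℝ} (hr : 0 ≤ r) (hb : 0 ≤ b)
    (hBr : ∀ l j, B' l j ≠ 0 → tdist1 Nf (loc l) (loc j) ≤ r) (hBb : ∀ j, ∑ l, ‖B' l j‖ ≤ b) :
    RawEntryLetters (fun u => Δ u * B') loc R ρ (b * B * Real.exp (2 * ρ * r)) := by
  have hs := rawEntryLetters_sandwich (locp := loc) h hρ (A := Matrix.diagonal fun _ => (1 : ℂ)) (B' := B') (r := r)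
    zero_le_one hb (fun i k hik => (range_diagonal loc _ i k hik).trans hr) (fun i => by rw [rowsum_diagonal, norm_one])
    hBr hBb
  refine rawEntryLetters_mono (rawEntryLetters_congr hs fun u _ => ?_) le_rfl le_rfl (le_of_eq (by ring))
  rw [Matrix.diagonal_one, Matrix.one_mul]

end Sandwich

end Literature.MathematicalPhysics.QuantumFieldTheory.Balaban1983to89.B13EntryLetterAlgebra

end
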